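import Summits.QuantumFields.YangMills.Theorems.CovariantDischargeHaarSweepReweighting
import Summits.QuantumFields.YangMills.Theorems.CovariantDischargeDirectionNet
import Literature.MathematicalPhysics.QuantumFieldTheory.Balaban1983to89.T3Thresholds
import HarnessLib

/-!
# Line «covariant_discharge» on crux `HistoryTailL` (stmt-QuantumFields-19936) — the KERNEL-CHECKED REDUCTION of its hardest stub
# `stub_unboundedDepth` to ONE deterministic inequality family: «a Haar-preserving sweep whose undoing lowers the Wilson action by
# `≥ c_g·p(g_{K−j})² − D` on the one-directional window event»

Cell `ym3-torus` (YM ladder rung R3 = continuum SU(2) Yang–Mills on the three-torus — a RUNG, NOT the Clay problem: not d = 4, not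
infinite volume, not a mass gap), width seat `ym-ust-19936-w3` gen 8, third helper brick (E-3).  It COMPOSES the two landed bricks
(E-1) `CovariantDischargeHaarSweepReweighting` (the exact reweighting identity `μ_β(A) = ∫_{Ψ⁻¹A} e^{−β(A(ΨU)−A(U))} dμ_β` and its tail
corollary) and (E-2) `CovariantDischargeDirectionNet` (finite direction net on `S² ⊂ ℝ³`, union bound, `SU(2)` dictionary
`‖imVec‖² = dist1²(1 − dist1²/4)`) with the threshold smallness `θ(b₂)(i) ≤ 1` for `γ ≤ γ₁(b₂, p₀)` (lit `T3Thresholds.exists_gamma_forall_θBal_le`):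

* §1 `measureReal_gibbsMeasure_le_exp_neg_of_gap` — the tail corollary in «image form» and WITHOUT ANY MEASURABILITY of the event:
  `(∀ V ∈ A, m ≤ β(A(V) − A(Ψ′V))) ⇒ μ_β(A) ≤ e^{−m}` for every `dU`-preserving measurable bijection `(Ψ, Ψ′)` and EVERY set `A`
  (the gap set `{m ≤ β(A − A∘Ψ′)}` is measurable and contains `A`); `gibbsK` form `gibbsK_real_le_exp_neg_of_gap`.
* §2 ★`measureReal_dist1_window_le_card_mul_exp` — for ANY event `A`, ANY `SU(2)`-valued statistic `H`, thresholds `0 ≤ θ`, `θ₂ ≤ 2`, a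
  direction set `s` (`∀ v, ∃ n ∈ s, c′‖v‖ ≤ ⟨n,v⟩`, `c′ ≥ 0`) and, FOR EACH `n ∈ s`, one admissible `(Ψ, Ψ′)` with gap `m` on
  `A ∩ {dist1 H ≤ θ₂} ∩ {c′θ√(1−θ₂²/4) ≤ ⟨n, imVec(su2Quat H)⟩}`:  `μ_β(A ∩ {dist1 H ≤ θ₂} ∩ {θ ≤ dist1 H}) ≤ #s · e^{−m}`.
* §3 ★★★`unboundedDepth_of_sweepGap` — THE REDUCTION: the displayed hypothesis (HGap) implies the text of `stub_unboundedDepth` of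
  `Cruxes/HistoryTailL/Lines/covariant_discharge.lean` VERBATIM, with `C = #net(δ)·e^{D}`, `N = 0`, `c = c_g`.  (HGap) reads: for every `L`
  there are `j₀, N₁ > 0` such that for every profile `(b₀, p₀, b₂)` there are `γ₁ ∈ (0,1]`, `c_g > 0`, `D`, `δ ∈ (0, √2]` such that for
  every family `F` (`F.L = L`), coupling `0 < γ ≤ γ₁`, depth `j₀ < j`, `N₁·j ≤ K`, plaquette `p` of `T^{(j)}` and unit direction `n ∈ ℝ³`
  there is a `dU`-preserving measurable bijection `(Ψ, Ψ′)` of the level-`K` fine fields with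
  `c_g·p(g_{K−j})² − D ≤ β_K·(A(V) − A(Ψ′V))` for every `V` in the `b₀`-history window with `b₂`-small top field and
  `(1−δ²/2)·θ(b₀)(K−j)·√(1 − θ(b₂)(K−j)²/4) ≤ ⟨n, imVec(su2Quat(Ū^j(V)(∂p)))⟩` — the card's sentence
  «`β_K(S(ΨU)−S(U)) = (θ/σ²)·Y_n̂(U) + ½β_K Σ(da)² + DEFECT`, sign of `n̂` against the event» as ONE inequality, nothing else.

WHAT THIS IS NOT.  A reduction, not a proof: (HGap) — the covariant sweep, its frames, the deterministic defect budget `≤ 1` for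
`N₁ ≥ 7` — is the XL content of the line and is NOT supplied here; nothing of `stub_unboundedDepth`, `DeepWindowTailL`, `FractionalWindowTailL`,
the crux `HistoryTailL`, the rung R3, d = 4, a continuum limit or a mass gap is proved.  YM₃ on T³ is rung R3, NOT the Clay problem.

References: T. Bałaban, CMP **102** (1985) 255–275 [Balaban1985UV3] ((1)–(3) p.256 the Wilson density, (7) p.257 the thresholds
`p(g) = b₀(1 + log g⁻¹)^{p₀}`); the measure theory is folklore.
-/

noncomputable section

open MeasureTheory
open scoped RealInnerProductSpace
open Literature.MathematicalPhysics.QuantumLattice (su2Quat)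
open Literature.MathematicalPhysics.QuantumFieldTheory.Balaban1983to89
open Literature.MathematicalPhysics.QuantumFieldTheory.Balaban1983to89.Missing (measurable_wilsonAction4)
open Literature.MathematicalPhysics.QuantumFieldTheory.Balaban1983to89.T3ContinuumYM3Torus
open Literature.MathematicalPhysics.QuantumFieldTheory.Balaban1983to89.T3UnitScaleTilt
open Literature.MathematicalPhysics.QuantumFieldTheory.Balaban1983to89.T3UnitLawDensityEML (ℰp)
open Literature.MathematicalPhysics.QuantumFieldTheory.Balaban1983to89.T4CubeChartGnomonic (SU2)
open Literature.MathematicalPhysics.QuantumFieldTheory.Balaban1983to89.T4ExpWindowSmallField (imVec)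
open Summit.QuantumFields.YangMills.Theorems.CovariantDischargeHaarSweepReweighting
open Summit.QuantumFields.YangMills.Theorems.CovariantDischargeDirectionNet

namespace Summit.QuantumFields.YangMills.Theorems.CovariantDischargeSweepGapReduction

/-! ## §1 The tail corollary in image form, for arbitrary (non-measurable) events -/

section Gap

variable {P : Params} {G : Type*} [GaugeGroup G] [MeasurableSpace G] [HaarData G] [RegularGaugeGroup G]

/-- **TAIL COROLLARY, IMAGE FORM, NO MEASURABILITY.**  For `β ≥ 0`, a `dU`-preserving measurable bijection `Ψ` with measurable inverse
`Ψ′`, ANY set `A` of fine fields and a gap `m ≤ β(A(V) − A(Ψ′V))` for every `V ∈ A` (undoing the sweep LOWERS the action by `m/β` on the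
event): `μ_β(A) ≤ e^{−m}`.  The measurable gap set `{V | m ≤ β(A(V) − A(Ψ′V))}` contains `A` and has pre-image gap `m`
(`CovariantDischargeHaarSweepReweighting.measureReal_gibbsMeasure_le_exp_neg`). [cite: Balaban1985UV3, (1)-(3) p.256] -/
theorem measureReal_gibbsMeasure_le_exp_neg_of_gap {β : ℝ} (hβ : 0 ≤ β) {Ψ Ψ' : GaugeField P 0 G → GaugeField P 0 G}
    (hΨ : MeasurePreserving Ψ (fieldMeasure P 0 G) (fieldMeasure P 0 G)) (hΨ' : Measurable Ψ')
    (h₁ : Function.LeftInverse Ψ' Ψ) (h₂ : Function.RightInverse Ψ' Ψ) (A : Set (GaugeField P 0 G)) {m : ℝ}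
    (hgap : ∀ V ∈ A, m ≤ β * (wilsonAction4 V - wilsonAction4 (Ψ' V))) :
    (T4GenFunBounds.gibbsMeasure P β).real A ≤ Real.exp (-m) := by
  haveI := T4GenFunBounds.isProbabilityMeasure_gibbsMeasure (G := G) P hβ
  have hA4 := measurable_wilsonAction4 (P := P) (j := 0) (RegularGaugeGroup.measurable_reTr (G := G))
  set B : Set (GaugeField P 0 G) := {V | m ≤ β * (wilsonAction4 V - wilsonAction4 (Ψ' V))} with hB_def
  have hBm : MeasurableSet B := measurableSet_le measurable_const ((hA4.sub (hA4.comp hΨ')).const_mul β)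
  have hAB : A ⊆ B := fun V hV => hgap V hV
  refine (measureReal_mono hAB (measure_ne_top _ _)).trans ?_
  refine measureReal_gibbsMeasure_le_exp_neg hβ hΨ hΨ' h₁ h₂ hBm fun U hU => ?_
  have hU' : m ≤ β * (wilsonAction4 (Ψ U) - wilsonAction4 (Ψ' (Ψ U))) := hU
  rwa [h₁ U] at hU'

end Gap

section GapK

variable (F : T3Family) {G : Type*} [GaugeGroup G] [MeasurableSpace G] [HaarData G] [RegularGaugeGroup G]
  (ℰ : LoopAverage G) {γ : ℝ}

/-- The same for `T3UnitScaleTilt.gibbsK F ℰ γ K` (`γ ≥ 0`, `β_K = (F.scheme ℰ γ).β K`). [cite: Balaban1985UV3, (1)-(3) p.256] -/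
theorem gibbsK_real_le_exp_neg_of_gap (hγ : 0 ≤ γ) (K : ℕ) {Ψ Ψ' : GaugeField (F.P K) 0 G → GaugeField (F.P K) 0 G}
    (hΨ : MeasurePreserving Ψ (fieldMeasure (F.P K) 0 G) (fieldMeasure (F.P K) 0 G)) (hΨ' : Measurable Ψ')
    (h₁ : Function.LeftInverse Ψ' Ψ) (h₂ : Function.RightInverse Ψ' Ψ) (A : Set (GaugeField (F.P K) 0 G)) {m : ℝ}
    (hgap : ∀ V ∈ A, m ≤ (F.scheme ℰ γ).β K * (wilsonAction4 V - wilsonAction4 (Ψ' V))) :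
    (gibbsK F ℰ γ K).real A ≤ Real.exp (-m) :=
  measureReal_gibbsMeasure_le_exp_neg_of_gap (F.scheme_β_nonneg ℰ hγ K) hΨ hΨ' h₁ h₂ A hgap

end GapK

/-! ## §2 One `(K, j, p)`: the `dist1`-window tail under per-direction sweep gaps -/

section Assembly

variable {P : Params}

/-- **THE `dist1`-WINDOW TAIL UNDER PER-DIRECTION SWEEP GAPS.**  `G = SU(2)`, `β ≥ 0`, ANY event `A` and `SU(2)`-valued statistic `H`
of the fine fields, thresholds `0 ≤ θ`, `θ₂ ≤ 2`, a direction set `s ⊂ ℝ³` with `∀ v, ∃ n ∈ s, c′‖v‖ ≤ ⟨n, v⟩` (`c′ ≥ 0`), and for EACH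
`n ∈ s` a `dU`-preserving measurable bijection `(Ψ, Ψ′)` with gap `m ≤ β(A(V) − A(Ψ′V))` on
`A ∩ {dist1 H ≤ θ₂} ∩ {c′·θ·√(1−θ₂²/4) ≤ ⟨n, imVec(su2Quat(H V))⟩}`.  Then `μ_β(A ∩ {dist1 H ≤ θ₂} ∩ {θ ≤ dist1 H}) ≤ #s · e^{−m}`
(union bound over the net, then §1 per direction; no measurability of `A` or `H` is needed). [cite: Balaban1985UV3, (1)-(3) p.256] -/
theorem measureReal_dist1_window_le_card_mul_exp {β : ℝ} (hβ : 0 ≤ β) (s : Finset (EuclideanSpace ℝ (Fin 3))) {c' : ℝ}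
    (hc' : 0 ≤ c') (hnet : ∀ v : EuclideanSpace ℝ (Fin 3), ∃ n ∈ s, c' * ‖v‖ ≤ ⟪n, v⟫)
    (A : Set (GaugeField P 0 SU2)) (H : GaugeField P 0 SU2 → SU2) {θ θ₂ : ℝ} (hθ : 0 ≤ θ) (hθ₂ : θ₂ ≤ 2) {m : ℝ}
    (hgap : ∀ n ∈ s, ∃ Ψ Ψ' : GaugeField P 0 SU2 → GaugeField P 0 SU2,
      MeasurePreserving Ψ (fieldMeasure P 0 SU2) (fieldMeasure P 0 SU2) ∧ Measurable Ψ' ∧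
      Function.LeftInverse Ψ' Ψ ∧ Function.RightInverse Ψ' Ψ ∧
      ∀ V : GaugeField P 0 SU2, V ∈ A → dist1 (H V) ≤ θ₂ →
        c' * (θ * Real.sqrt (1 - θ₂ ^ 2 / 4)) ≤ ⟪n, imVec (su2Quat (H V))⟫ →
        m ≤ β * (wilsonAction4 V - wilsonAction4 (Ψ' V))) :
    (T4GenFunBounds.gibbsMeasure P β).real {U | U ∈ A ∧ dist1 (H U) ≤ θ₂ ∧ θ ≤ dist1 (H U)} ≤
      s.card * Real.exp (-m) := by
  haveI := T4GenFunBounds.isProbabilityMeasure_gibbsMeasure (G := SU2) P hβ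
  refine (measureReal_dist1_window_le_sum s hc' hnet A H hθ hθ₂).trans ?_
  refine (Finset.sum_le_card_nsmul s _ (Real.exp (-m)) fun n hn => ?_).trans_eq (nsmul_eq_mul _ _)
  obtain ⟨Ψ, Ψ', hΨ, hΨ', h₁, h₂, hg⟩ := hgap n hn
  exact measureReal_gibbsMeasure_le_exp_neg_of_gap hβ hΨ hΨ' h₁ h₂ _ fun V hV => hg V hV.1.1 hV.1.2 hV.2

end Assembly

/-! ## §3 The reduction of `stub_unboundedDepth` to the sweep-gap hypothesis (HGap) -/

section Reduction

open Literature.MathematicalPhysics.QuantumFieldTheory.Balaban1983to89.T3Thresholds (exists_gamma_forall_θBal_le)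
open Literature.MathematicalPhysics.QuantumFieldTheory.Balaban1983to89.T3MinimiserStabilityReduction (θBal_pos)

/-- **`stub_unboundedDepth` OF LINE «covariant_discharge» FROM THE SWEEP-GAP HYPOTHESIS (HGap).**  The hypothesis is displayed in the
module docstring; the conclusion is the registered stub's text VERBATIM.  Proof: `γ₁ := min γ₁(HGap) γ₁(θ(b₂) ≤ 1)` (lit
`exists_gamma_forall_θBal_le`), a `δ`-net `s` of `S²` (`exists_finset_sphere_inner_ge`), `C := #s·e^{D}`, `N := 0`, `c := c_g`; the window
event is contained in `A ∩ {dist1 ≤ θ(b₂)} ∩ {θ(b₀) ≤ dist1}` with `A` = history window ∧ `b₂`-small top field (the top smallness gives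
`dist1(Ū^j(∂p)) < θ(b₂)`), and §2 applies with the gap `m = c_g·p² − D`. [cite: Balaban1985UV3, (7) p.257 and (71) p.273] -/
theorem unboundedDepth_of_sweepGap
    (hGap : open Literature.MathematicalPhysics.QuantumFieldTheory.Balaban1983to89 Literature.MathematicalPhysics.QuantumFieldTheory.Balaban1983to89.T3ContinuumYM3Torus in ∀ (L : ℕ), ∃ (j₀ N₁ : ℕ), 0 < N₁ ∧ ∀ (b₀ p₀ b₂ : ℝ), 0 < b₀ → 2 < p₀ → b₀ ≤ b₂ → ∃ (γ₁ cg D δ : ℝ), 0 < γ₁ ∧ γ₁ ≤ 1 ∧ 0 < cg ∧ 0 < δ ∧ δ ^ 2 ≤ 2 ∧ ∀ (F : T3Family) (γ : ℝ), F.L = L → 0 < γ → γ ≤ γ₁ → ∀ (K j : ℕ), j₀ < j → N₁ * j ≤ K → ∀ (p : Plaq (F.P K) j) (n : EuclideanSpace ℝ (Fin 3)), ‖n‖ = 1 → ∃ (Ψ Ψ' : GaugeField (F.P K) 0 (Matrix.specialUnitaryGroup (Fin 2) ℂ) → GaugeField (F.P K) 0 (Matrix.specialUnitaryGroup (Fin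 2) ℂ)), MeasurePreserving Ψ (fieldMeasure (F.P K) 0 (Matrix.specialUnitaryGroup (Fin 2) ℂ)) (fieldMeasure (F.P K) 0 (Matrix.specialUnitaryGroup (Fin 2) ℂ)) ∧ Measurable Ψ' ∧ Function.LeftInverse Ψ' Ψ ∧ Function.RightInverse Ψ' Ψ ∧ ∀ V : GaugeField (F.P K) 0 (Matrix.specialUnitaryGroup (Fin 2) ℂ), (∀ k, k < j → PlaqSmall (T3UnitScaleTilt.θBal F.L γ b₀ p₀ (K - k)) (Averaging.iter (fun i => BlockAveraging.blockAvg (P := F.P K) (j := i) T3UnitLawDensityEML.ℰp) k V)) → PlaqSmall (T3UnitScaleTilt.θBal F.L γ b₂ p₀ (K - j)) (Averaging.iter (fun i => BlockAveraging.blockAvg (P := F.P K) (j := i) T3UnitLawDensityEML.ℰp) j V) → (1 - δ ^ 2 / 2) * (T3UnitScaleTilt.θBal F.L γ b₀ p₀ (K - j) * Real.sqrt (1 - T3UnitScaleTilt.θBal F.L γ b₂ p₀ (K - j) ^ 2 / 4)) ≤ ⟪n, T4ExpWindowSmallField.imVec (Literature.MathematicalPhysics.QuantumLattice.su2Quat (GaugeField.plaqHol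 (Averaging.iter (fun i => BlockAveraging.blockAvg (P := F.P K) (j := i) T3UnitLawDensityEML.ℰp) j V) p))⟫ → cg * B10.pFun b₀ p₀ (Real.sqrt (γ * ((F.L : ℝ)⁻¹) ^ (K - j))) ^ 2 - D ≤ (F.scheme T3UnitLawDensityEML.ℰp γ).β K * (wilsonAction4 V - wilsonAction4 (Ψ' V))) :
    open Literature.MathematicalPhysics.QuantumFieldTheory.Balaban1983to89 Literature.MathematicalPhysics.QuantumFieldTheory.Balaban1983to89.T3ContinuumYM3Torus in ∀ (L : ℕ), ∃ (j₀ N₁ : ℕ), 0 < N₁ ∧ ∀ (b₀ p₀ b₂ : ℝ), 0 < b₀ → 2 < p₀ → b₀ ≤ b₂ → ∃ (γ₁ C c : ℝ) (N : ℕ), 0 < γ₁ ∧ γ₁ ≤ 1 ∧ 0 < c ∧ ∀ (F : T3Family) (γ : ℝ), F.L = L → 0 < γ → γ ≤ γ₁ → ∀ (K j : ℕ), j₀ < j → N₁ * j ≤ K → ∀ p : Plaq (F.P K) j, (T3UnitScaleTilt.gibbsK F T3UnitLawDensityEML.ℰp γ K).real {U | (∀ k, k < j → PlaqSmall (T3UnitScaleTilt.θBal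 F.L γ b₀ p₀ (K - k)) (Averaging.iter (fun i => BlockAveraging.blockAvg (P := F.P K) (j := i) T3UnitLawDensityEML.ℰp) k U)) ∧ PlaqSmall (T3UnitScaleTilt.θBal F.L γ b₂ p₀ (K - j)) (Averaging.iter (fun i => BlockAveraging.blockAvg (P := F.P K) (j := i) T3UnitLawDensityEML.ℰp) j U) ∧ T3UnitScaleTilt.θBal F.L γ b₀ p₀ (K - j) ≤ GaugeGroup.dist1 (GaugeField.plaqHol (Averaging.iter (fun i => BlockAveraging.blockAvg (P := F.P K) (j := i) T3UnitLawDensityEML.ℰp) j U) p)} ≤ C * ((γ * ((F.L : ℝ)⁻¹) ^ (K - j))⁻¹) ^ N * Real.exp (-(c * B10.pFun b₀ p₀ (Real.sqrt (γ * ((F.L : ℝ)⁻¹) ^ (K - j))) ^ 2)) := by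
  intro L
  obtain ⟨j₀, N₁, hN₁, hG⟩ := hGap L
  refine ⟨j₀, N₁, hN₁, fun b₀ p₀ b₂ hb₀ hp₀ hb₂ => ?_⟩
  obtain ⟨γ₁, cg, D, δ, hγ₁, hγ₁1, hcg, hδ, hδ2, hG'⟩ := hG b₀ p₀ b₂ hb₀ hp₀ hb₂
  -- `θ(b₂)(i) ≤ 1` for `γ ≤ γθ`, uniformly in `L ≥ 1` and `i`
  obtain ⟨γθ, hγθ, hγθ1, hθ1⟩ :=
    exists_gamma_forall_θBal_le (b₀ := b₂) (p₀ := p₀) (hb₀.trans_le hb₂) (by linarith) one_pos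
  -- the direction net
  obtain ⟨s, _hne, hs1, hnet⟩ := exists_finset_sphere_inner_ge (E := EuclideanSpace ℝ (Fin 3)) hδ
  refine ⟨min γ₁ γθ, s.card * Real.exp D, cg, 0, lt_min hγ₁ hγθ, (min_le_left _ _).trans hγ₁1, hcg, ?_⟩
  intro F γ hFL hγ hγ1 K j hj hjK p
  have hL1 : 1 ≤ L := by rw [← hFL]; exact F.hL.2.le
  have hγa : γ ≤ γ₁ := hγ1.trans (min_le_left _ _)
  have hγb : γ ≤ γθ := hγ1.trans (min_le_right _ _)
  have hγone : γ ≤ 1 := hγa.trans hγ₁1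
  -- thresholds
  set θ : ℝ := θBal F.L γ b₀ p₀ (K - j) with hθ_def
  set θ₂ : ℝ := θBal F.L γ b₂ p₀ (K - j) with hθ₂_def
  have hθ0 : 0 ≤ θ := (θBal_pos (hFL ▸ hL1) hγ hγone hb₀ p₀ (K - j)).le
  have hθ₂2 : θ₂ ≤ 2 := (hθ1 F.L (hFL ▸ hL1) γ hγ hγb (K - j)).trans one_le_two
  -- the event and the statistic
  set A : Set (GaugeField (F.P K) 0 SU2) := {U | (∀ k, k < j → PlaqSmall (θBal F.L γ b₀ p₀ (K - k))
      (Averaging.iter (fun i => BlockAveraging.blockAvg (P := F.P K) (j := i) ℰp) k U)) ∧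
    PlaqSmall θ₂ (Averaging.iter (fun i => BlockAveraging.blockAvg (P := F.P K) (j := i) ℰp) j U)} with hA_def
  set H : GaugeField (F.P K) 0 SU2 → SU2 := fun U =>
    GaugeField.plaqHol (Averaging.iter (fun i => BlockAveraging.blockAvg (P := F.P K) (j := i) ℰp) j U) p with hH_def
  haveI := isProbabilityMeasure_gibbsK F ℰp hγ.le K
  haveI := T4GenFunBounds.isProbabilityMeasure_gibbsMeasure (G := SU2) (F.P K) (F.scheme_β_nonneg ℰp hγ.le K)
  -- the window event is contained in `A ∩ {dist1 H ≤ θ₂} ∩ {θ ≤ dist1 H}`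
  have hsub : {U : GaugeField (F.P K) 0 SU2 | (∀ k, k < j → PlaqSmall (θBal F.L γ b₀ p₀ (K - k))
      (Averaging.iter (fun i => BlockAveraging.blockAvg (P := F.P K) (j := i) ℰp) k U)) ∧
      PlaqSmall (θBal F.L γ b₂ p₀ (K - j)) (Averaging.iter (fun i => BlockAveraging.blockAvg (P := F.P K) (j := i) ℰp) j U) ∧
      θBal F.L γ b₀ p₀ (K - j) ≤ dist1 (GaugeField.plaqHol
        (Averaging.iter (fun i => BlockAveraging.blockAvg (P := F.P K) (j := i) ℰp) j U) p)} ⊆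
      {U | U ∈ A ∧ dist1 (H U) ≤ θ₂ ∧ θ ≤ dist1 (H U)} := by
    intro U hU
    exact ⟨⟨hU.1, hU.2.1⟩, (hU.2.1 p).le, hU.2.2⟩
  -- per-direction gaps from (HGap)
  have hgap : ∀ n ∈ s, ∃ Ψ Ψ' : GaugeField (F.P K) 0 SU2 → GaugeField (F.P K) 0 SU2,
      MeasurePreserving Ψ (fieldMeasure (F.P K) 0 SU2) (fieldMeasure (F.P K) 0 SU2) ∧ Measurable Ψ' ∧
      Function.LeftInverse Ψ' Ψ ∧ Function.RightInverse Ψ' Ψ ∧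
      ∀ V : GaugeField (F.P K) 0 SU2, V ∈ A → dist1 (H V) ≤ θ₂ →
        (1 - δ ^ 2 / 2) * (θ * Real.sqrt (1 - θ₂ ^ 2 / 4)) ≤ ⟪n, imVec (su2Quat (H V))⟫ →
        cg * B10.pFun b₀ p₀ (Real.sqrt (γ * ((F.L : ℝ)⁻¹) ^ (K - j))) ^ 2 - D ≤
          (F.scheme ℰp γ).β K * (wilsonAction4 V - wilsonAction4 (Ψ' V)) := by
    intro n hn
    obtain ⟨Ψ, Ψ', hΨ, hΨ', h₁, h₂, hg⟩ := hG' F γ hFL hγ hγa K j hj hjK p n (hs1 n hn)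
    exact ⟨Ψ, Ψ', hΨ, hΨ', h₁, h₂, fun V hV _ hlin => hg V hV.1 hV.2 hlin⟩
  have hmain := measureReal_dist1_window_le_card_mul_exp (P := F.P K) (F.scheme_β_nonneg ℰp hγ.le K) s
    (by linarith : (0 : ℝ) ≤ 1 - δ ^ 2 / 2) hnet A H hθ0 hθ₂2 hgap
  set Z : ℝ := B10.pFun b₀ p₀ (Real.sqrt (γ * ((F.L : ℝ)⁻¹) ^ (K - j))) ^ 2 with hZ_def
  have hexp : Real.exp (-(cg * Z - D)) = Real.exp D * Real.exp (-(cg * Z)) := by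
    rw [← Real.exp_add]; congr 1; ring
  rw [gibbsK_eq]
  refine ((measureReal_mono hsub (measure_ne_top _ _)).trans hmain).trans (le_of_eq ?_)
  rw [pow_zero, mul_one, hexp, mul_assoc]

end Reduction

end Summit.QuantumFields.YangMills.Theorems.CovariantDischargeSweepGapReduction

end
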